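import Summits.HodgeConjecture.HodgeConjecture.Theorems.F0P3InnerFormClassificationV8      -- ★ V8-D (the `h2` edition): `shape_of_T5`, `KitFamily`, `KitFamily.IsPinned`, the laws' readers; same imports ∕ opens
import Summits.HodgeConjecture.HodgeConjecture.Theorems.F0P3ThreadLetters3Defs              -- ★ p864888: `KitFamilyLaws₃` (S5-R20: ONE text home, BY NAME)
import HarnessLib

/-!
# `F0P3InnerFormClassificationV83` — T5-D, TWO-COMPACT-PLACE TWIN (R90-TF THREAD-₃ lane 2, file (E-2)): the frame-universal composition
# `shapeGuarded₃_of_T5` over a named `KitFamily` with the ₃ LAWS ★ `F0P3ThreadLetters3Defs.KitFamilyLaws₃` ⇒ the v4 head text at frames with two compact places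

F0∕P3 «U3-mult», cell `hodgecm-mathlib`, crux H413 (`stmt-HodgeConjecture-24833`); R90-TF slab S5, prover K2E3-p17 (g12), deal (H26) (S5 dealer R90-C133-plan (g3)
2026-09-05T03:08:49Z: «E-2 = twin of ★ `KitFamily.shapeGuarded_of_T5` over `F0P3ThreadLetters3Defs.KitFamilyLaws₃`, ★ proof verbatim, `h3` threaded»); census
`R90/R90-C133-p01/g2/CENSUS-L7.md` 9974659a §3 (E-2); heir LEAD F0P3a-plan (g22) RULING (R-44) (C)(7); director (g40) s2043 (c)(ii)(iii); RULING S5-R19 «₃ twins live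
Summits-side»; RULING S5-R20 «ONE TEXT HOME, TWO LANES».  PROOF lane (ONE theorem; no `def`, no instance, no notation, no `sorry`); ADDITIVE (a new module beside ★
`F0P3InnerFormClassificationV8`, which is untouched and imported for `shape_of_T5`, `KitFamily`, `KitFamily.IsPinned` and the laws' readers);
`--supports stmt-HodgeConjecture-24833 --as helper`.  Sibling naming convention of the thread: `<★ source module>3` (★ `F0P3StubE1hFold3`, `F0P3StubS3FoldCoh3`, …).
HONEST LABEL: this file pays nothing until AGG's ₃ edition consumes (E-1) `letters_of_specPkgV8W_cot₃`; HC_CM is proved only modulo the 7 printed citations (2 remaining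
named inputs: hLiu418 = stmt-HodgeConjecture-24832, h413 = stmt-HodgeConjecture-24833) until rung 0 closes.

WHY A TWIN.  The R90-TF road pays letter #80's finite-place organ from the Arthur-simple trace formula, which needs TWO compact real places of the definite unitary group
(`3 ≤ [L⁺:ℚ]`); AGG (`Lines/F0_U3LettersRung1.lean`) DERIVES E1_coh ∕ E2′ from the rung-0 rows (:651 ★ `letters_of_specPkgV8W_cot`), and with ₃ rows (law #15 Routing comes
from `stub_L3₃`) only `KitFamilyLaws₃` is available, so the V8 engine chain must run in the ₃ currency: (E-2) THIS FILE `shapeGuarded₃_of_T5` → (E-3) ★-to-be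
`F0P3GuardedLettersOfGuardedShape3.letters_of_guardedEngine₃` (whose hypothesis `h` is THIS conclusion, token for token) → (E-1) `F0P3KitOfRecordLawsV8W3.letters_of_specPkgV8W_cot₃`.

WHAT CHANGES w.r.t. ★ `F0P3InnerFormClassificationV8.shapeGuarded_of_T5` (:226–:281; everything else VERBATIM): `hlaws : 𝔎.Laws` ↦ `hlaws₃ : F0P3ThreadLetters3Defs.KitFamilyLaws₃ 𝔎`
(★ V8 `KitFamily.Laws` :210 body with the ONE `3 ≤ …` binder after `h2`) BY NAME; conclusion ↦ the v4 head text (:227–:272) with ONE inserted line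
`3 ≤ Module.finrank ℚ ↥(maximalRealSubfield L) →` after the kept `2 ≤ …` line; the proof introduces `h3` beside `h2` and passes `hdef h2 h3` at the ONE application of
`hlaws₃` — the pin `hpin … hdef h2 …`, the per-frame head ★ `shape_of_T5` and the laws' readers (`coefficientFormula_of_laws_grouped`, `perClassIdentity_of_laws`,
`separation_of_laws`, `hatInjective_of_pins`) are frame-local and stay `h2` (kits and pins exist at every `h2` frame; only the LAWS need `h3`).  PRINT-FAITHFULNESS (director
s2043 (iii)): «`3 ≤ [F⁺:ℚ]` is implied by Hyp413 (`6 ≤ [F:ℚ]`); the weakening costs nothing at the summit; anchor [Rogawski1990 §13.3 (13.3.6(c)), two compact places]» —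
the `3 ≤` clause is a ROUTE restriction of the R90-TF road, not a hypothesis of Rogawski's theorems.
References: as in ★ `F0P3InnerFormClassificationV8` ([Rogawski1990] §14.6 Thm. 14.6.4 pp. 236–239; §13.7 p. 206; §15.3 ¶1; Prop. 15.2.1; §14.2 p. 228 l. 1; Thm. 13.3.6 (c)).
-/

attribute [local instance 100] LieRing.ofAssociativeRing

set_option autoImplicit false
-- the mandated namespace repeats `HodgeConjecture.HodgeConjecture`, as in every `Theorems/*.lean` of this sub-problem
set_option linter.dupNamespace false

noncomputable section

open NumberField IsDedekindDomain MeasureTheory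
open scoped Matrix ComplexOrder BigOperators Classical

namespace Summit.HodgeConjecture.HodgeConjecture.Cruxes.H413.F0P3InnerFormClassificationV83

open Literature.NumberTheory.Rogawski1990 Literature.NumberTheory.GaloisRepresentations
open Literature.NumberTheory.Automorphic Literature.NumberTheory.Automorphic.UnitaryGroup
open Literature.NumberTheory.Automorphic.UnitaryGroup.CotangentForms
open Literature.RepresentationTheory.BorelWallach2000
open Literature.RepresentationTheory.KonnoKonno2007
open Summit.HodgeConjecture.HodgeConjecture.Cruxes.H413.F0P3InnerFormClassificationV6   -- ★ F0P3ClassificationKitV6: §0 frame abbreviations, §1 `Sockets`, the kit structure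
open Summit.HodgeConjecture.HodgeConjecture.Cruxes.H413.F0P3InnerFormClassificationV6.ClassificationKit   -- ★ §1.1 derived notation, §1.2 `IsPinned`
open Summit.HodgeConjecture.HodgeConjecture.Cruxes.H413.F0P3InnerFormClassificationV8   -- ★ V8-D: `shape_of_T5`, `KitFamily`, `KitFamily.IsPinned`, laws' readers

/-! ## §5₃ THE COMPOSITION over a NAMED KIT FAMILY with the ₃ LAWS, in the letters' frame shape with two compact places -/

/-- **`shapeGuarded₃_of_T5`** — TWO-COMPACT-PLACE TWIN of ★ `F0P3InnerFormClassificationV8.shapeGuarded_of_T5`: a NAMED pinned kit family whose LAWS hold at every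
letters' frame WITH TWO COMPACT PLACES (★ `F0P3ThreadLetters3Defs.KitFamilyLaws₃ 𝔎`, for some level guard `S₀` per frame) ⇒ `∀ compact CM frame with 3 ≤ [L⁺:ℚ],
(C1♮) ∧ (C2♯) ∧ (C3♯)` for COTANGENT-TYPE, `Kc`-TRIVIAL `P`, spelled LITERALLY (the v4 head text + ONE `3 ≤ …` line = the hypothesis `h` of ★-to-be
`F0P3GuardedLettersOfGuardedShape3.letters_of_guardedEngine₃`, token for token).  Proof = ★ :273–:281 verbatim with `h3` introduced beside `h2` and passed at the ONE
application of `hlaws₃`; the pin and the per-frame head ★ `shape_of_T5` stay `h2`. [cite: Rogawski1990, §14.6 Thm. 14.6.4; Prop. 15.2.1; Thm. 13.3.6 (c)] -/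
theorem shapeGuarded₃_of_T5 (𝔎 : KitFamily) (hpin : KitFamily.IsPinned 𝔎) (hlaws₃ : F0P3ThreadLetters3Defs.KitFamilyLaws₃ 𝔎) :
    ∀ (L : Type) [Field L] [NumberField L] [IsCMField L] (ι : L →+* ℂ) (H : Matrix (Fin 3) (Fin 3) L) (T : GL (Fin 3) ℂ)
      (hT : (T : Matrix (Fin 3) (Fin 3) ℂ)ᴴ * H.map ι * (T : Matrix (Fin 3) (Fin 3) ℂ) = Literature.Geometry.ComplexHyperbolic.BallModel.J),
      (∀ τ' : L →+* ℂ, InfinitePlace.mk τ' ≠ InfinitePlace.mk ι → (H.map τ').PosDef) →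
      2 ≤ Module.finrank ℚ ↥(maximalRealSubfield L) →
      3 ≤ Module.finrank ℚ ↥(maximalRealSubfield L) →
      ∀ (μ : Measure (adelicGroupData (↥(maximalRealSubfield L)) L (IsCMField.complexConj L) 3 H).automorphicQuotient)
        [(adelicGroupData (↥(maximalRealSubfield L)) L (IsCMField.complexConj L) 3 H).IsAutomorphicMeasure μ]
        (μω : HeckeCharacter L) (hμu : μω.IsUnitary),
        (∀ x : Literature.NumberTheory.GaloisRepresentations.ideleGroup ↥(maximalRealSubfield L),
          μω (AdeleRing.ideleBaseChange (↥(maximalRealSubfield L)) L x) = quadraticHeckeCharCM L x) →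
      (∀ (P : DiscreteAutomorphicRep (adelicGroupData (↥(maximalRealSubfield L)) L (IsCMField.complexConj L) 3 H) μ),
          (P.IsHolCotangentAt (cmArchSection L ι H T hT) (cmCompactFactor L ι H T hT) ∨
            P.IsAntiholCotangentAt (cmArchSection L ι H T hT) (cmCompactFactor L ι H T hT)) →
          (∀ k : (adelicGroupData (↥(maximalRealSubfield L)) L (IsCMField.complexConj L) 3 H).Adelic, k ∈ cmCompactFactor L ι H T hT → ∀ v : P.space.toSubmodule, (adelicGroupData (↥(maximalRealSubfield L)) L (IsCMField.complexConj L) 3 H).rightRegular μ k (v : (adelicGroupData (↥(maximalRealSubfield L)) L (IsCMField.complexConj L) 3 H).L2 μ) = v) → ∀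
          (M : Type) [AddCommGroup M] [Module ℂ M]
          (σK : Representation ℂ (uFormGroup (Fin 2) (Fin 1)).maximalCompact M) (σ𝔤 : (uFormGroup (Fin 2) (Fin 1)).lie →ₗ⁅ℝ⁆ Module.End ℂ M)
          (hM : IsGKModule (uFormGroup (Fin 2) (Fin 1)) σK σ𝔤), IsIrreducibleGK σK σ𝔤 →
          (∃ T₁ : P.archModuleCM ι T hT →ₗ[ℂ] M,
            (∀ (k : (uFormGroup (Fin 2) (Fin 1)).maximalCompact) (w : P.archModuleCM ι T hT), T₁ (P.archRepKCM ι T hT k w) = σK k (T₁ w)) ∧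
              (∀ (X : (uFormGroup (Fin 2) (Fin 1)).lie) (w : P.archModuleCM ι T hT), T₁ (P.archRepLieCM ι T hT X w) = σ𝔤 X (T₁ w)) ∧ T₁ ≠ 0) →
          ∀ δ : ℤ, (δ = 1 ∨ δ = -1) → upqTypeClasses σK σ𝔤 hM.ad_compat 1 δ ≠ ⊥ →
            ((adelicGroupData (↥(maximalRealSubfield L)) L (IsCMField.complexConj L) 3 H).rightRegular μ).multiplicity P.space.toContRep ≤ 1) ∧
      (∀ (P : DiscreteAutomorphicRep (adelicGroupData (↥(maximalRealSubfield L)) L (IsCMField.complexConj L) 3 H) μ),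
          (P.IsHolCotangentAt (cmArchSection L ι H T hT) (cmCompactFactor L ι H T hT) ∨
            P.IsAntiholCotangentAt (cmArchSection L ι H T hT) (cmCompactFactor L ι H T hT)) →
          (∀ k : (adelicGroupData (↥(maximalRealSubfield L)) L (IsCMField.complexConj L) 3 H).Adelic, k ∈ cmCompactFactor L ι H T hT → ∀ v : P.space.toSubmodule, (adelicGroupData (↥(maximalRealSubfield L)) L (IsCMField.complexConj L) 3 H).rightRegular μ k (v : (adelicGroupData (↥(maximalRealSubfield L)) L (IsCMField.complexConj L) 3 H).L2 μ) = v) → ∀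
          (M : Type) [AddCommGroup M] [Module ℂ M]
          (σK : Representation ℂ (uFormGroup (Fin 2) (Fin 1)).maximalCompact M) (σ𝔤 : (uFormGroup (Fin 2) (Fin 1)).lie →ₗ⁅ℝ⁆ Module.End ℂ M)
          (hM : IsGKModule (uFormGroup (Fin 2) (Fin 1)) σK σ𝔤), IsIrreducibleGK σK σ𝔤 →
          (∃ T₁ : P.archModuleCM ι T hT →ₗ[ℂ] M,
            (∀ (k : (uFormGroup (Fin 2) (Fin 1)).maximalCompact) (w : P.archModuleCM ι T hT), T₁ (P.archRepKCM ι T hT k w) = σK k (T₁ w)) ∧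
              (∀ (X : (uFormGroup (Fin 2) (Fin 1)).lie) (w : P.archModuleCM ι T hT), T₁ (P.archRepLieCM ι T hT X w) = σ𝔤 X (T₁ w)) ∧ T₁ ≠ 0) →
          ∀ δ : ℤ, (δ = 1 ∨ δ = -1) → upqTypeClasses σK σ𝔤 hM.ad_compat 1 δ ≠ ⊥ →
            ∃ ξ : OneDimAutRepH L, MemXiFamily P (transpose_map_cmConjRingHom_eq_of_frame L ι H T hT) (isUnit_det_of_frame L ι H T hT) μω hμu ξ ∧
              ∀ k : InfinitePlace L → ℤ, μω.HasUnitaryArchType k (fun _ => 0) → ∀ ι' : L →+* ℂ, ξ.IsCohTrivialAt (ArchSignRecipe.tOfArchType k ι') ι') ∧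
      (∃ sgn : OneDimAutRepH L → ℤ, ∀ (P : DiscreteAutomorphicRep (adelicGroupData (↥(maximalRealSubfield L)) L (IsCMField.complexConj L) 3 H) μ),
          (P.IsHolCotangentAt (cmArchSection L ι H T hT) (cmCompactFactor L ι H T hT) ∨
            P.IsAntiholCotangentAt (cmArchSection L ι H T hT) (cmCompactFactor L ι H T hT)) →
          (∀ k : (adelicGroupData (↥(maximalRealSubfield L)) L (IsCMField.complexConj L) 3 H).Adelic, k ∈ cmCompactFactor L ι H T hT → ∀ v : P.space.toSubmodule, (adelicGroupData (↥(maximalRealSubfield L)) L (IsCMField.complexConj L) 3 H).rightRegular μ k (v : (adelicGroupData (↥(maximalRealSubfield L)) L (IsCMField.complexConj L) 3 H).L2 μ) = v) → ∀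
          (M : Type) [AddCommGroup M] [Module ℂ M]
          (σK : Representation ℂ (uFormGroup (Fin 2) (Fin 1)).maximalCompact M) (σ𝔤 : (uFormGroup (Fin 2) (Fin 1)).lie →ₗ⁅ℝ⁆ Module.End ℂ M)
          (hM : IsGKModule (uFormGroup (Fin 2) (Fin 1)) σK σ𝔤), IsIrreducibleGK σK σ𝔤 →
          (∃ T₁ : P.archModuleCM ι T hT →ₗ[ℂ] M,
            (∀ (k : (uFormGroup (Fin 2) (Fin 1)).maximalCompact) (w : P.archModuleCM ι T hT), T₁ (P.archRepKCM ι T hT k w) = σK k (T₁ w)) ∧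
              (∀ (X : (uFormGroup (Fin 2) (Fin 1)).lie) (w : P.archModuleCM ι T hT), T₁ (P.archRepLieCM ι T hT X w) = σ𝔤 X (T₁ w)) ∧ T₁ ≠ 0) →
          ∀ δ : ℤ, (δ = 1 ∨ δ = -1) → upqTypeClasses σK σ𝔤 hM.ad_compat 1 δ ≠ ⊥ →
            ∃ ξ : OneDimAutRepH L, MemXiFamily P (transpose_map_cmConjRingHom_eq_of_frame L ι H T hT) (isUnit_det_of_frame L ι H T hT) μω hμu ξ ∧ δ = sgn ξ ∧
              ∀ k : InfinitePlace L → ℤ, μω.HasUnitaryArchType k (fun _ => 0) → ∀ ι' : L →+* ℂ, ξ.IsCohTrivialAt (ArchSignRecipe.tOfArchType k ι') ι') := by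
  intro L _ _ _ ι H T hT hdef h2 h3 μ _ μω hμu hμω
  have hp := hpin L ι H T hT hdef h2 μ μω hμu hμω
  -- Theorems edition: `Exists.elim` instead of `obtain ⟨S₀, hl⟩ := …` (same proof term; elaborates at DEFAULT heartbeats)
  exact (hlaws₃ L ι H T hT hdef h2 h3 μ μω hμu hμω).elim fun S₀ hl =>
    shape_of_T5 H ι T hT μ μω hμu (𝔎 L ι H T hT hdef h2 μ μω hμu hμω) hp hl
    (ClassificationKit.coefficientFormula_of_laws_grouped _
      (perClassIdentity_of_laws _ hl.traceIdentity hl.spectralSideGp hl.factorisation hl.matchingS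
        (separation_of_laws _ (hatInjective_of_pins _ hp hl.evpConvention) hl.hatBounded hl.unrStarAlgebra) hl.unrStarAlgebra)
      hl.transferS hl.linIndepS hl.unitaryCoord hl.unitaryPacket hl.aPacketSpectral hl.localExpansion)

end Summit.HodgeConjecture.HodgeConjecture.Cruxes.H413.F0P3InnerFormClassificationV83

end
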